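import Summits.AtomisticToContinuum.HydrodynamicLimit.Theorems.CollisionIsometryCLTMacroClosureBlockMGFCore
import Summits.AtomisticToContinuum.HydrodynamicLimit.Theorems.CollisionIsometryCLTMacroClosureBlockMGFPositionBound
import Summits.AtomisticToContinuum.HydrodynamicLimit.Theorems.CollisionIsometryCLTMacroClosureTwoScaleAdmissible
import Summits.AtomisticToContinuum.HydrodynamicLimit.Theorems.CollisionIsometryCLTMacroClosureTwoScaleOccupation
import Summits.AtomisticToContinuum.HydrodynamicLimit.Theorems.CollisionIsometryCLTMacroClosureTwoScaleRates
import Summits.AtomisticToContinuum.HydrodynamicLimit.Theorems.CollisionIsometryCLTMacroClosureTwoScalePatternVolume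
import Summits.AtomisticToContinuum.HydrodynamicLimit.Theorems.CollisionIsometryCLTMacroClosureTwoScalePatternAsymptotics
import Summits.AtomisticToContinuum.HydrodynamicLimit.Theorems.CollisionIsometryCLTMacroClosureRuelleConvexity
import HarnessLib

/-!
# The TWO-SCALE homogeneous sub-unit block MGF (registered stub `stub_blockMGF_twoScale` of the line
`IdeatorTwoGen1Sketch`, crux `MacroClosure`, stmt-AtomisticToContinuum-14870)

Proof file (`--supports stmt-AtomisticToContinuum-14870`) of the line lead (continuation c2) for the LAST statics
stub of the line: SOME pair of admissible kernel families — the box-smoothed family `boxFamily` (`b_ℓ ⋆ ψ_{ℓ/8}`,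
`ℓ = side N = 1/mesh N ≍ (N+1)^{-1/15}`) and the fine mollifier family `fineFamily` (`ψ_{ℓ/128}`), admissible by
`stub_twoScale_admissible` — carries the two-scale homogeneous sub-unit block MGF. Assembly of the landed pieces:
the fixed-`N` core `BlockMGFTwoScale.mgf_core` (pointwise reduction by Jensen + tiling + rate splitting, Tonelli,
velocity factorisation), the configurational bound `BlockMGFTwoScale.positionBound` (pattern volume, pattern
asymptotics, partition function), the occupation floor/ceiling `stub_twoScale_occupation`, the two rates
`stub_twoScale_rates`, and the eventual-in-`N` arithmetic `K^{M³}(N+2)^{M³}e^{ε(N+1)/2} + 1 ≤ e^{ε(N+1)}`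
(`M³ ≤ 128³(N+1)^{1/5}`).
-/

noncomputable section

open MeasureTheory Filter Set Topology InformationTheory
open scoped ENNReal ContDiff Convolution

namespace Summit.AtomisticToContinuum.HydrodynamicLimit.Theorems.MacroClosureLine

open Literature.MathematicalPhysics.KineticTheory Literature.Analysis.FluidPDE
open Literature.Analysis.FunctionSpaces
open Summit.AtomisticToContinuum.HydrodynamicLimit.Theses

namespace Barycentric

namespace BlockMGFTwoScale

/-- `t^{1/5} ≤ η t` and `t^{2/5} ≤ η t` eventually along `t = N + 1`, for every `η > 0`. [folklore] -/
theorem eventually_rpow_le (η : ℝ) (hη : 0 < η) {p : ℝ} (hp1 : p < 1) :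
    ∀ᶠ N : ℕ in atTop, ((N : ℝ) + 1) ^ p ≤ η * ((N : ℝ) + 1) := by
  have ht : Tendsto (fun N : ℕ => ((N : ℝ) + 1) ^ (-(1 - p))) atTop (𝓝 0) :=
    (tendsto_rpow_neg_atTop (by linarith)).comp
      (tendsto_atTop_add_const_right atTop (1 : ℝ) tendsto_natCast_atTop_atTop)
  filter_upwards [(tendsto_order.1 ht).2 η hη] with N hN
  have hx : (0 : ℝ) < (N : ℝ) + 1 := by positivity
  have e : ((N : ℝ) + 1) ^ p = ((N : ℝ) + 1) ^ (-(1 - p)) * ((N : ℝ) + 1) := by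
    rw [← Real.rpow_add_one hx.ne']; congr 1; ring
  rw [e]
  exact mul_le_mul_of_nonneg_right hN.le hx.le

/-- **The eventual arithmetic**: `K₁^{M³} (N+2)^{M³} e^{ε(N+1)/2} + 1 ≤ e^{ε(N+1)}` eventually, `K₁ = max K 1`,
`M = mesh N` (`M³ ≤ 128³ (N+1)^{1/5}`, `log(N+2) ≤ 10 (N+1)^{1/5}`). [folklore] -/
theorem eventually_arith (K ε : ℝ) (hε : 0 < ε) : ∀ᶠ N : ℕ in atTop,
    ENNReal.ofReal (max K 1) ^ (mesh N) ^ 3 *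
        (((N : ℝ≥0∞) + 2) ^ (mesh N) ^ 3 * ENNReal.ofReal (Real.exp (2 * (ε / 4) * ((N : ℝ) + 1)))) + 1 ≤
      ENNReal.ofReal (Real.exp (ε * ((N : ℝ) + 1))) := by
  set K₁ : ℝ := max K 1 with hK₁
  have hK₁1 : 1 ≤ K₁ := le_max_right _ _
  have hK₁0 : 0 < K₁ := lt_of_lt_of_le one_pos hK₁1
  set A : ℝ := Real.log K₁ with hA
  have hA0 : 0 ≤ A := Real.log_nonneg hK₁1
  have hC0 : (0 : ℝ) < 128 ^ 3 := by norm_num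
  -- the three eventual conditions
  have h1 := eventually_rpow_le (ε / (8 * 128 ^ 3 * (A + 1))) (by positivity) (p := 1 / 5) (by norm_num)
  have h2 := eventually_rpow_le (ε / (80 * 128 ^ 3)) (by positivity) (p := 2 / 5) (by norm_num)
  have h3 : ∀ᶠ N : ℕ in atTop, Real.log 2 ≤ ε / 4 * ((N : ℝ) + 1) := by
    have ht : Tendsto (fun N : ℕ => ε / 4 * ((N : ℝ) + 1)) atTop atTop :=
      (tendsto_atTop_add_const_right atTop (1 : ℝ) tendsto_natCast_atTop_atTop).const_mul_atTop (by positivity)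
    exact ht.eventually_ge_atTop _
  filter_upwards [h1, h2, h3] with N hN1 hN2 hN3
  set t : ℝ := (N : ℝ) + 1 with ht
  have ht0 : 0 < t := by positivity
  have ht1 : 1 ≤ t := by rw [ht]; linarith [(Nat.cast_nonneg N : (0 : ℝ) ≤ N)]
  set M : ℕ := mesh N with hM
  -- `M³ ≤ 128³ t^{1/5}`
  have hM3 : ((M : ℕ) : ℝ) ^ 3 ≤ 128 ^ 3 * t ^ (1 / 5 : ℝ) := by
    have hm := TwoScaleAdmissible.mesh_le N
    have h0 : (0 : ℝ) ≤ (M : ℕ) := Nat.cast_nonneg _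
    calc ((M : ℕ) : ℝ) ^ 3 ≤ (128 * t ^ (1 / 15 : ℝ)) ^ 3 := pow_le_pow_left₀ h0 hm 3
      _ = 128 ^ 3 * (t ^ (1 / 15 : ℝ)) ^ 3 := by ring
      _ = 128 ^ 3 * t ^ (1 / 5 : ℝ) := by
          rw [← Real.rpow_natCast (t ^ (1 / 15 : ℝ)) 3, ← Real.rpow_mul ht0.le]; norm_num
  -- `log (t+1) ≤ 10 t^{1/5}`
  have hlog : Real.log (t + 1) ≤ 10 * t ^ (1 / 5 : ℝ) := by
    have h := Real.log_le_rpow_div (show (0 : ℝ) ≤ t + 1 by positivity) (show (0 : ℝ) < 1 / 5 by norm_num)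
    have h2t : (t + 1) ^ (1 / 5 : ℝ) ≤ 2 * t ^ (1 / 5 : ℝ) := by
      calc (t + 1) ^ (1 / 5 : ℝ) ≤ (2 * t) ^ (1 / 5 : ℝ) :=
            Real.rpow_le_rpow (by positivity) (by linarith) (by norm_num)
        _ = 2 ^ (1 / 5 : ℝ) * t ^ (1 / 5 : ℝ) := Real.mul_rpow (by norm_num) ht0.le
        _ ≤ 2 * t ^ (1 / 5 : ℝ) := by
            refine mul_le_mul_of_nonneg_right ?_ (Real.rpow_nonneg ht0.le _)
            calc (2 : ℝ) ^ (1 / 5 : ℝ) ≤ 2 ^ (1 : ℝ) := Real.rpow_le_rpow_of_exponent_le (by norm_num) (by norm_num)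
              _ = 2 := Real.rpow_one 2
    calc Real.log (t + 1) ≤ (t + 1) ^ (1 / 5 : ℝ) / (1 / 5) := h
      _ = 5 * (t + 1) ^ (1 / 5 : ℝ) := by ring
      _ ≤ 10 * t ^ (1 / 5 : ℝ) := by linarith
  -- the logarithm of the main term
  set X : ℝ := K₁ ^ M ^ 3 * (t + 1) ^ M ^ 3 * Real.exp (2 * (ε / 4) * t) with hX
  have hX0 : 0 < X := by positivity
  have hlogX : Real.log X ≤ 3 / 4 * ε * t := by
    have e1 : Real.log X = ((M : ℕ) : ℝ) ^ 3 * (A + Real.log (t + 1)) + 2 * (ε / 4) * t := by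
      rw [hX, Real.log_mul (by positivity) (by positivity), Real.log_mul (by positivity) (by positivity),
        Real.log_exp, Real.log_pow, Real.log_pow, hA]
      push_cast
      ring
    rw [e1]
    have hlt : ((M : ℕ) : ℝ) ^ 3 * (A + Real.log (t + 1)) ≤ 128 ^ 3 * t ^ (1 / 5 : ℝ) * (A + 10 * t ^ (1 / 5 : ℝ)) := by
      have hlogpos : 0 ≤ Real.log (t + 1) := Real.log_nonneg (by linarith)
      calc ((M : ℕ) : ℝ) ^ 3 * (A + Real.log (t + 1)) ≤ 128 ^ 3 * t ^ (1 / 5 : ℝ) * (A + Real.log (t + 1)) :=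
            mul_le_mul_of_nonneg_right hM3 (by positivity)
        _ ≤ 128 ^ 3 * t ^ (1 / 5 : ℝ) * (A + 10 * t ^ (1 / 5 : ℝ)) := by
            refine mul_le_mul_of_nonneg_left (by linarith) (by positivity)
    have hsq : t ^ (1 / 5 : ℝ) * t ^ (1 / 5 : ℝ) = t ^ (2 / 5 : ℝ) := by
      rw [← Real.rpow_add ht0]; norm_num
    have hb1 : 128 ^ 3 * t ^ (1 / 5 : ℝ) * A ≤ ε / 8 * t := by
      have hA1 : A / (A + 1) ≤ 1 := (div_le_one (by positivity)).2 (by linarith)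
      calc 128 ^ 3 * t ^ (1 / 5 : ℝ) * A ≤ 128 ^ 3 * (ε / (8 * 128 ^ 3 * (A + 1)) * t) * A := by
            gcongr
        _ = ε / 8 * t * (A / (A + 1)) := by field_simp
        _ ≤ ε / 8 * t * 1 := by gcongr
        _ = ε / 8 * t := mul_one _
    have hb2 : 128 ^ 3 * (10 * t ^ (2 / 5 : ℝ)) ≤ ε / 8 * t := by
      calc 128 ^ 3 * (10 * t ^ (2 / 5 : ℝ)) ≤ 128 ^ 3 * (10 * (ε / (80 * 128 ^ 3) * t)) := by gcongr
        _ = ε / 8 * t := by field_simp; ring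
    have hexp : 128 ^ 3 * t ^ (1 / 5 : ℝ) * (A + 10 * t ^ (1 / 5 : ℝ)) =
        128 ^ 3 * t ^ (1 / 5 : ℝ) * A + 128 ^ 3 * (10 * t ^ (2 / 5 : ℝ)) := by rw [← hsq]; ring
    linarith
  -- `X + 1 ≤ 2 max X 1 ≤ 2 e^{3εt/4} ≤ e^{εt}`
  have hX1 : X ≤ Real.exp (3 / 4 * ε * t) := by
    rw [← Real.exp_log hX0]; exact Real.exp_le_exp.2 hlogX
  have hreal : X + 1 ≤ Real.exp (ε * t) := by
    have h2 : (2 : ℝ) ≤ Real.exp (ε / 4 * t) := by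
      rw [← Real.exp_log two_pos]; exact Real.exp_le_exp.2 hN3
    have hprod : Real.exp (3 / 4 * ε * t) * Real.exp (ε / 4 * t) = Real.exp (ε * t) := by
      rw [← Real.exp_add]; congr 1; ring
    have h1' : 1 ≤ Real.exp (3 / 4 * ε * t) := Real.one_le_exp (by positivity)
    nlinarith [Real.exp_pos (3 / 4 * ε * t), Real.exp_pos (ε / 4 * t)]
  -- conversion to `ℝ≥0∞`
  have hconv : ENNReal.ofReal K₁ ^ M ^ 3 *
      (((N : ℝ≥0∞) + 2) ^ M ^ 3 * ENNReal.ofReal (Real.exp (2 * (ε / 4) * t))) + 1 = ENNReal.ofReal (X + 1) := by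
    have hN2 : ((N : ℝ≥0∞) + 2) = ENNReal.ofReal (t + 1) := by
      rw [ht, show (N : ℝ) + 1 + 1 = (N : ℝ) + 2 by ring, ENNReal.ofReal_add (by positivity) (by norm_num),
        ENNReal.ofReal_natCast, ENNReal.ofReal_ofNat]
    rw [hN2, ← ENNReal.ofReal_pow hK₁0.le, ← ENNReal.ofReal_pow (by positivity),
      ← ENNReal.ofReal_mul (by positivity), ← ENNReal.ofReal_mul (by positivity), ← ENNReal.ofReal_one,
      ← ENNReal.ofReal_add (by positivity) zero_le_one]
    exact congrArg ENNReal.ofReal (by rw [hX]; ring)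
  rw [hconv]
  exact ENNReal.ofReal_le_ofReal hreal

end BlockMGFTwoScale

/-- **`stub_blockMGF_twoScale` (registered stub of the skeleton `Lines/IdeatorTwoGen1Sketch.lean`): the box-smoothed
family and the fine mollifier family carry the TWO-SCALE homogeneous sub-unit block MGF.** See the module
docstring. [cite: Ruelle1969, §3.4] -/
theorem stub_blockMGF_twoScale : ∃ (γ C : ℝ) (φ : ℕ → T3 → ℝ) (γ₂ C₂ : ℝ) (φ₂ : ℕ → T3 → ℝ),
    0 < γ ∧ γ ≤ 1 / 15 ∧ AdmissibleKernel γ C φ ∧ 0 < γ₂ ∧ γ₂ ≤ 1 / 15 ∧ AdmissibleKernel γ₂ C₂ φ₂ ∧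
    (∃ σ₀ : ℝ, 0 < σ₀ ∧ ∀ σ : ℝ, 0 < σ → σ < σ₀ → ∀ (uc : V3) (θc : ℝ), 0 < θc →
      ∀ c₁ : ℝ, 0 < c₁ → ∀ c₂ : ℝ, 0 < c₂ → ∀ γ' : ℝ, 0 < γ' → γ' < 1 → ∀ ε : ℝ, 0 < ε →
      ∀ᶠ N : ℕ in atTop, ∀ Φ : Flow σ N,
        ∫⁻ z, ENNReal.ofReal (Real.exp (γ' * ((N : ℝ) + 1) *
            {z : Config (N + 1) (Fin 3) T3 |
                (∀ x, c₁ ≤ bρ (φ N) z x ∧ bρ (φ N) z x * σ ^ 3 ≤ 1) ∧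
                (∀ x, c₂ ≤ bρ (φ₂ N) z x ∧ bρ (φ₂ N) z x * σ ^ 3 ≤ 1)}.indicator
              (fun z => ∫ x, max 0 (relEnt σ (bU (φ N) z x) (stateOf 1 uc θc))) z))
          ∂(localGibbsLaw σ (fun _ => 1) (fun _ => uc) (fun _ => θc) N Φ) ≤
        ENNReal.ofReal (Real.exp (ε * ((N : ℝ) + 1)))) := by
  obtain ⟨⟨C, C₂, hadm, hadm₂⟩, -, -⟩ := stub_twoScale_admissible
  refine ⟨1 / 15, C, boxFamily, 1 / 15, C₂, fineFamily, by norm_num, le_rfl, hadm, by norm_num, le_rfl, hadm₂, ?_⟩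
  obtain ⟨σ₁, hσ₁, HR⟩ := stub_twoScale_rates
  obtain ⟨κ₀, hκ₀, HO⟩ := stub_twoScale_occupation
  refine ⟨min (1 / 2) σ₁, lt_min one_half_pos hσ₁, ?_⟩
  intro σ hσ hσlt uc θc hθc c₁ _hc₁ c₂ hc₂ γ' hγ'0 hγ'1 ε hε
  have hσ2 : σ ≤ 1 / 2 := (lt_of_lt_of_le hσlt (min_le_left _ _)).le
  have hσσ₁ : σ < σ₁ := lt_of_lt_of_le hσlt (min_le_right _ _)
  obtain ⟨hRa, hRbH, hRid⟩ := HR σ hσ hσσ₁ uc θc hθc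
  have hRb := hRbH stub_hsFreeEnergyConvex
  obtain ⟨K, n₀, _hK, hVF⟩ := stub_twoScale_velocityFactor γ' hγ'0 hγ'1
  set a : ℝ := κ₀ * c₂ / 128 ^ 3 with ha_def
  have ha : 0 < a := by positivity
  have hPA := stub_twoScale_patternAsymptotics stub_hsFreeEnergyConvex σ a (ε / 4) hσ hσ2 ha (by positivity)
  have hPB := BlockMGFTwoScale.positionBound σ a γ' (ε / 4) hσ ha hγ'1.le uc θc hRa hRb stub_twoScale_patternVolume hPA.1 hPA.2
  -- the floor of the cubes grows
  have hev2 : ∀ᶠ N : ℕ in atTop, 2 ≤ a * (((N : ℝ) + 1) * side N ^ 3) ∧ (n₀ : ℝ) < a * (((N : ℝ) + 1) * side N ^ 3) := by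
    have h := (PatternAsymptotics.tendsto_cellMass.const_mul_atTop ha).eventually_ge_atTop (max 2 ((n₀ : ℝ) + 1))
    filter_upwards [h] with N hN
    exact ⟨(le_max_left _ _).trans hN, by linarith [le_max_right (2 : ℝ) ((n₀ : ℝ) + 1)]⟩
  filter_upwards [hPB, hev2, BlockMGFTwoScale.eventually_arith K ε hε] with N hPBN hfl hA Φ
  -- fixed `N`
  have hM := mesh_pos N
  have hℓ64 : side N ≤ 1 / 64 := TwoScaleAdmissible.side_le_inv N
  have hℓ0 : 0 < side N := TwoScaleAdmissible.side_pos N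
  have hocc : ∀ z : Config (N + 1) (Fin 3) T3,
      (∀ x, c₂ ≤ bρ (Torus.kernel (side N / 128) : T3 → ℝ) z x ∧
        bρ (Torus.kernel (side N / 128) : T3 → ℝ) z x * σ ^ 3 ≤ 1) →
      ∀ y, a * (((N : ℝ) + 1) * side N ^ 3) ≤ (cellCount (side N) z y : ℝ) ∧
        (cellCount (side N) z y : ℝ) * σ ^ 3 ≤ (1 + 1 / 64) ^ 3 * (((N : ℝ) + 1) * side N ^ 3) := by
    intro z hz y
    have h := HO (side N) (side N / 128) (by positivity) (by linarith) (by linarith) N σ c₂ hσ z hz y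
    constructor
    · calc a * (((N : ℝ) + 1) * side N ^ 3) = κ₀ * c₂ * (((N : ℝ) + 1) * (side N / 128) ^ 3) := by
            rw [ha_def]; ring
        _ ≤ _ := h.1
    · calc (cellCount (side N) z y : ℝ) * σ ^ 3 ≤ ((N : ℝ) + 1) * (side N + 2 * (side N / 128)) ^ 3 := h.2
        _ = (1 + 1 / 64) ^ 3 * (((N : ℝ) + 1) * side N ^ 3) := by ring
  have hcore := BlockMGFTwoScale.mgf_core N (mesh N) hM (side N) rfl hℓ64 stub_hsFreeEnergyConvex σ hσ hσ2 uc θc hθc hRb hRid γ'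
    hγ'0 hγ'1.le c₁ c₂ a K n₀ hVF hocc hfl.1 hfl.2 _ hPBN Φ
  refine le_trans (hcore.trans ?_) hA
  gcongr
  exact le_max_left _ _

end Barycentric

end Summit.AtomisticToContinuum.HydrodynamicLimit.Theorems.MacroClosureLine

end
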